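import Literature.AlgebraicGeometry.HodgeTheory.FermatHodgeCharacterPeelOdd
import HarnessLib

/-!
# Twin configurations `S ∪ wS` (Aoki 1983, Props. 8.3, 8.4 for `ℓ = 8`)

Support file XV (everything PROVED; no named facts, no definitions) for the structure theorem of
the Hodge characters of the Fermat surface (`AokiShioda1983_thmB2m_standard`).

In case `m = 2m'` (`m'` odd) the Hodge condition at the top level `m'` for four odd unit entries
`aᵢ` reads `(1 - χ̄(2)) ∑ χ(āᵢ) = 0`, i.e. the EIGHT points `āᵢ, v āᵢ` (`v = -2⁻¹`) are annihilated
by all odd primitive characters mod `m'` [Aoki1983, (I-5)]. `quad_of_twin` removes the twin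
factor: if `S ∪ wS` is annihilated, `w^L ≢ ±1 (mod q)` for `L ≤ 4` at a prime power `q ∥ f` whose
kernel leaves the sixteen residues `±`free, then `S` itself SPLITS into two annihilated pairs or
is `5`-quasi-standard — the conclusion of [Aoki1983, Prop. 8.2] for `S`. The proof is the
odd-world peel (engine v2) followed by the class combinatorics of [Aoki1983, Props. 8.3–8.4]:
no `±`-class mod `q` contains a point together with its twin, every class meets the
configuration in at least two points, whence only the patterns `(4)(4)` and `(2,2)(2,2)` survive.

## References

* [Aoki1983] N. Aoki, Math. Ann. 266 (1983) 23–54, Props. 8.2–8.4 and §9 (I-5) (text read).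
-/

noncomputable section

open Finset

namespace Literature.AlgebraicGeometry.HodgeTheory

namespace FermatCharacter

section Twin

variable {q n : ℕ} [NeZero q] [NeZero n]

/-- The concentrated case of the odd-world peel for four points, from the slice relation at the
common residue (extracted from `quad_odd_top`). [cite: Aoki1983, Prop. 8.2] -/
theorem quad_conc_of_rel [Fact (1 < q)] (h : q.Coprime n) (hq : IsUnit (2 : ZMod q))
    (hn : Odd n ∨ 4 ∣ n) (x : Fin 4 → (ZMod (q * n))ˣ)
    (hall : ∀ i, ZMod.castHom (dvd_mul_right q n) (ZMod q) (x i) =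
        ZMod.castHom (dvd_mul_right q n) (ZMod q) (x 0) ∨
      ZMod.castHom (dvd_mul_right q n) (ZMod q) (x i) =
        -ZMod.castHom (dvd_mul_right q n) (ZMod q) (x 0))
    (hrel : ∀ χ' : DirichletCharacter ℂ n, χ'.IsPrimitive →
      (∑ i, (if ZMod.castHom (dvd_mul_right q n) (ZMod q) (x i) =
          ZMod.castHom (dvd_mul_right q n) (ZMod q) (x 0) then
          χ' (ZMod.castHom (dvd_mul_left n q) (ZMod n) (x i)) else 0)) -
      χ' (-1) * ∑ i, (if ZMod.castHom (dvd_mul_right q n) (ZMod q) (x i) =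
          -ZMod.castHom (dvd_mul_right q n) (ZMod q) (x 0) then
          χ' (ZMod.castHom (dvd_mul_left n q) (ZMod n) (x i)) else 0) = 0) :
    (∃ i j k l : Fin 4, i ≠ j ∧ i ≠ k ∧ i ≠ l ∧ j ≠ k ∧ j ≠ l ∧ k ≠ l ∧
      (∀ χ : DirichletCharacter ℂ (q * n), χ.Odd → χ.IsPrimitive → χ (x i) + χ (x j) = 0) ∧
      (∀ χ : DirichletCharacter ℂ (q * n), χ.Odd → χ.IsPrimitive → χ (x k) + χ (x l) = 0)) ∨
    (∃ n₅ : ℕ, n = 5 * n₅ ∧ ¬ 5 ∣ n₅ ∧ ∀ (hd5 : q * n₅ ∣ q * n) (χ : DirichletCharacter ℂ (q * n₅)),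
      χ.Odd → χ.IsPrimitive → ∀ i j : Fin 4,
        χ (ZMod.castHom hd5 (ZMod (q * n₅)) (x i)) = χ (ZMod.castHom hd5 (ZMod (q * n₅)) (x j))) := by
  classical
  haveI : NeZero (q * n) := ⟨mul_ne_zero (NeZero.ne q) (NeZero.ne n)⟩
  set r : Fin 4 → ZMod q := fun i ↦ ZMod.castHom (dvd_mul_right q n) (ZMod q) (x i) with hr
  set x' : Fin 4 → (ZMod n)ˣ := fun i ↦ ZMod.unitsMap (dvd_mul_left n q) (x i) with hx'
  have hxval : ∀ i, ZMod.castHom (dvd_mul_left n q) (ZMod n) (x i) = (x' i : ZMod n) :=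
    fun i ↦ (coe_unitsMap _ _).symm
  have hru : ∀ i, IsUnit (r i) := fun i ↦ (Units.isUnit (x i)).map _
  have hself : ∀ i, r i ≠ -r i := by
    intro i he
    have h2 : (2 : ZMod q) * r i = 0 := by linear_combination he
    exact (hq.mul (hru i)).ne_zero h2
  change ∀ i, r i = r 0 ∨ r i = -r 0 at hall
  set ε : Fin 4 → ℂ := fun i ↦ if r i = r 0 then 1 else -1 with hε
  set pav : Fin 4 → (ZMod n)ˣ := fun i ↦ if r i = r 0 then x' i else -x' i with hpav
  have hεs : ∀ i, ε i = 1 ∨ ε i = -1 := by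
    intro i; simp only [hε]; split_ifs
    · exact Or.inl rfl
    · exact Or.inr rfl
  have hxp : ∀ (χ' : DirichletCharacter ℂ n) (i : Fin 4),
      χ' (x' i : ZMod n) = (if r i = r 0 then 1 else χ' (-1)) * χ' (pav i : ZMod n) := by
    intro χ' i
    simp only [hpav]
    split_ifs
    · rw [one_mul]
    · rw [Units.val_neg, ← map_mul, neg_one_mul, neg_neg]
  have hnull : ∀ χ' : DirichletCharacter ℂ n, χ'.IsPrimitive →
      ∑ i, ε i * χ' (pav i : ZMod n) = 0 := by
    intro χ' hχ'
    have rel := hrel χ' hχ'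
    change (∑ i, (if r i = r 0 then χ' (ZMod.castHom (dvd_mul_left n q) (ZMod n) (x i)) else 0)) -
      χ' (-1) * ∑ i, (if r i = -r 0 then χ' (ZMod.castHom (dvd_mul_left n q) (ZMod n) (x i)) else 0)
        = 0 at rel
    have hη2 : χ' (-1) * χ' (-1) = 1 := by rw [← map_mul, neg_one_mul, neg_neg, map_one]
    rw [Finset.mul_sum, ← Finset.sum_sub_distrib] at rel
    refine Eq.trans (Finset.sum_congr rfl fun i _ ↦ ?_) rel
    rw [hxval, hxp χ' i]
    simp only [hε]
    rcases hall i with hi | hi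
    · have hne : ¬ r i = -r 0 := fun h' ↦ hself 0 (hi.symm.trans h')
      rw [if_pos hi, if_pos hi, if_pos hi, if_neg hne]
      ring
    · have hne : ¬ r i = r 0 := fun h' ↦ hself 0 (h'.symm.trans hi)
      rw [if_neg hne, if_neg hne, if_neg hne, if_pos hi]
      linear_combination (χ' (pav i : ZMod n)) * hη2
  have hterm : ∀ (χ₁ : DirichletCharacter ℂ q) (χ' : DirichletCharacter ℂ n),
      χ₁ (-1) * χ' (-1) = -1 → ∀ i,
      χ₁ (r i) * χ' (x' i : ZMod n) = χ₁ (r 0) * (ε i * χ' (pav i : ZMod n)) := by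
    intro χ₁ χ' hpar i
    rw [hxp χ' i]
    simp only [hε]
    rcases hall i with hi | hi
    · simp only [hi, if_true, one_mul]
    · have hne : ¬ r i = r 0 := fun h' ↦ hself 0 (h'.symm.trans hi)
      rw [if_neg hne, if_neg hne, hi, ← neg_one_mul (r 0), map_mul]
      linear_combination (χ₁ (r 0) * χ' (pav i : ZMod n)) * hpar
  rcases quad_allprim n (NeZero.ne n) hn pav ε hεs hnull with
    ⟨i, j, k, l, n1, n2, n3, n4, n5, n6, hp1, hp2⟩ | ⟨n₅, hn5, h5, H⟩
  · left
    refine ⟨i, j, k, l, n1, n2, n3, n4, n5, n6, fun χ hodd hχ ↦ ?_, fun χ hodd hχ ↦ ?_⟩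
    · obtain ⟨χ₁, χ', rfl, hp⟩ := exists_eq_prodChar h χ
      obtain ⟨-, h2'⟩ := hp hχ
      have hpar : χ₁ (-1) * χ' (-1) = -1 := by
        have := hodd; rw [DirichletCharacter.Odd, prodChar_neg_one] at this; exact this
      rw [prodChar_apply, prodChar_apply, hxval, hxval]
      change χ₁ (r i) * χ' (x' i : ZMod n) + χ₁ (r j) * χ' (x' j : ZMod n) = 0
      rw [hterm χ₁ χ' hpar i, hterm χ₁ χ' hpar j, ← mul_add, hp1 χ' h2', mul_zero]
    · obtain ⟨χ₁, χ', rfl, hp⟩ := exists_eq_prodChar h χ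
      obtain ⟨-, h2'⟩ := hp hχ
      have hpar : χ₁ (-1) * χ' (-1) = -1 := by
        have := hodd; rw [DirichletCharacter.Odd, prodChar_neg_one] at this; exact this
      rw [prodChar_apply, prodChar_apply, hxval, hxval]
      change χ₁ (r k) * χ' (x' k : ZMod n) + χ₁ (r l) * χ' (x' l : ZMod n) = 0
      rw [hterm χ₁ χ' hpar k, hterm χ₁ χ' hpar l, ← mul_add, hp2 χ' h2', mul_zero]
  · right
    have hn₅0 : n₅ ≠ 0 := fun h0 ↦ NeZero.ne n (by rw [hn5, h0, mul_zero])
    haveI : NeZero n₅ := ⟨hn₅0⟩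
    haveI : NeZero (q * n₅) := ⟨mul_ne_zero (NeZero.ne q) hn₅0⟩
    have hd5 : n₅ ∣ n := ⟨5, by rw [hn5, mul_comm]⟩
    have hcop5 : q.Coprime n₅ := Nat.Coprime.coprime_dvd_right hd5 h
    refine ⟨n₅, hn5, h5, fun hd' χ hodd hχ i j ↦ ?_⟩
    obtain ⟨χ₁, χ₀, rfl, hp⟩ := exists_eq_prodChar hcop5 χ
    obtain ⟨-, h0'⟩ := hp hχ
    have hpar : χ₁ (-1) * χ₀ (-1) = -1 := by
      have := hodd; rw [DirichletCharacter.Odd, prodChar_neg_one] at this; exact this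
    have heval : ∀ i, (DirichletCharacter.changeLevel (dvd_mul_right q n₅) χ₁ *
        DirichletCharacter.changeLevel (dvd_mul_left n₅ q) χ₀) (ZMod.castHom hd' (ZMod (q * n₅)) (x i)) =
        χ₁ (r i) * χ₀ (ZMod.castHom hd5 (ZMod n₅) (x' i : ZMod n)) := by
      intro i
      rw [prodChar_apply, castHom_castHom, castHom_castHom, ← hxval, castHom_castHom]
    have hterm₀ : ∀ i, χ₁ (r i) * χ₀ (ZMod.castHom hd5 (ZMod n₅) (x' i : ZMod n)) =
        χ₁ (r 0) * (ε i * χ₀ (ZMod.castHom hd5 (ZMod n₅) (pav i : ZMod n))) := by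
      intro i
      simp only [hε, hpav]
      rcases hall i with hi | hi
      · simp only [hi, if_true, one_mul]
      · have hne : ¬ r i = r 0 := fun h' ↦ hself 0 (h'.symm.trans hi)
        rw [if_neg hne, if_neg hne, hi, ← neg_one_mul (r 0), map_mul, Units.val_neg,
          map_neg (ZMod.castHom hd5 (ZMod n₅)),
          ← neg_one_mul (ZMod.castHom hd5 (ZMod n₅) (x' i : ZMod n)), map_mul]
        have hη2 : χ₀ (-1) * χ₀ (-1) = 1 := by rw [← map_mul, neg_one_mul, neg_neg, map_one]
        linear_combination
          (χ₁ (r 0) * χ₀ (ZMod.castHom hd5 (ZMod n₅) (x' i : ZMod n)) * χ₀ (-1)) * hpar -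
          (χ₁ (r 0) * χ₀ (ZMod.castHom hd5 (ZMod n₅) (x' i : ZMod n)) * χ₁ (-1)) * hη2
    rw [heval, heval, hterm₀ i, hterm₀ j, H hd5 χ₀ h0' i j]

/-! ### `±`-class bookkeeping -/

omit [NeZero q] in
/-- Symmetry of the `±`-class relation. [folklore] -/
theorem pm_symm {a b : ZMod q} (h : b = a ∨ b = -a) : a = b ∨ a = -b := by
  rcases h with h | h
  · exact Or.inl h.symm
  · right; rw [h, neg_neg]

omit [NeZero q] in
/-- Transitivity of the `±`-class relation. [folklore] -/
theorem pm_trans {a b c : ZMod q} (h1 : b = a ∨ b = -a) (h2 : c = b ∨ c = -b) : c = a ∨ c = -a := by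
  rcases h1 with h1 | h1 <;> rcases h2 with h2 | h2
  · exact Or.inl (h2.trans h1)
  · right; rw [h2, h1]
  · right; rw [h2, h1]
  · left; rw [h2, h1, neg_neg]

omit [NeZero q] in
/-- The `±`-class relation is preserved by multiplication. [folklore] -/
theorem pm_mul (c : ZMod q) {a b : ZMod q} (h : b = a ∨ b = -a) : c * b = c * a ∨ c * b = -(c * a) := by
  rcases h with h | h
  · exact Or.inl (by rw [h])
  · right; rw [h, mul_neg]

omit [NeZero q] in
/-- The `±`-class relation is reflected by multiplication by a unit. [folklore] -/
theorem pm_cancel {c : ZMod q} (hc : IsUnit c) {a b : ZMod q} (h : c * b = c * a ∨ c * b = -(c * a)) :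
    b = a ∨ b = -a := by
  rcases h with h | h
  · exact Or.inl (hc.mul_left_cancel h)
  · right; rw [← mul_neg] at h; exact hc.mul_left_cancel h

/-- **Twin configurations** ([Aoki1983, Props. 8.3–8.4 for `ℓ = 8`]). If the eight points
`xᵢ, w xᵢ` are annihilated by all odd primitive characters mod `q n`, the sixteen residues
`± xᵢ, ± w xᵢ` mod `q` leave every `±`-class free, and `w^L ≢ ±1 (mod q)` for `1 ≤ L ≤ 4`, then
the four points `xᵢ` split into two annihilated pairs or are `5`-quasi-standard.
[cite: Aoki1983, Props. 8.3, 8.4] -/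
theorem quad_of_twin [Fact (1 < q)] (h : q.Coprime n) {d : ℕ} (hd : d ∣ q)
    (hprim : ∀ χ : DirichletCharacter ℂ q, ¬ χ.FactorsThrough d → χ.IsPrimitive)
    (hq : IsUnit (2 : ZMod q)) (hn : Odd n ∨ 4 ∣ n)
    (x : Fin 4 → (ZMod (q * n))ˣ) (w : (ZMod (q * n))ˣ)
    (hw : ∀ L : ℕ, 1 ≤ L → L ≤ 4 →
      ZMod.castHom (dvd_mul_right q n) (ZMod q) ((w ^ L : (ZMod (q * n))ˣ) : ZMod (q * n)) ≠ 1 ∧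
      ZMod.castHom (dvd_mul_right q n) (ZMod q) ((w ^ L : (ZMod (q * n))ˣ) : ZMod (q * n)) ≠ -1)
    (hT : ∀ χ : DirichletCharacter ℂ (q * n), χ.Odd → χ.IsPrimitive →
      ∑ i, χ (x i) + ∑ i, χ (w * x i) = 0)
    (hfreeAll : ∀ y : (ZMod q)ˣ, ∃ u : (ZMod q)ˣ, ZMod.unitsMap hd u = 1 ∧
      (∀ i, ZMod.castHom (dvd_mul_right q n) (ZMod q) (x i) ≠ (u : ZMod q) * y ∧
        ZMod.castHom (dvd_mul_right q n) (ZMod q) (x i) ≠ -((u : ZMod q) * y)) ∧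
      (∀ i, ZMod.castHom (dvd_mul_right q n) (ZMod q) (w * x i) ≠ (u : ZMod q) * y ∧
        ZMod.castHom (dvd_mul_right q n) (ZMod q) (w * x i) ≠ -((u : ZMod q) * y))) :
    (∃ i j k l : Fin 4, i ≠ j ∧ i ≠ k ∧ i ≠ l ∧ j ≠ k ∧ j ≠ l ∧ k ≠ l ∧
      (∀ χ : DirichletCharacter ℂ (q * n), χ.Odd → χ.IsPrimitive → χ (x i) + χ (x j) = 0) ∧
      (∀ χ : DirichletCharacter ℂ (q * n), χ.Odd → χ.IsPrimitive → χ (x k) + χ (x l) = 0)) ∨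
    (∃ n₅ : ℕ, n = 5 * n₅ ∧ ¬ 5 ∣ n₅ ∧ ∀ (hd5 : q * n₅ ∣ q * n) (χ : DirichletCharacter ℂ (q * n₅)),
      χ.Odd → χ.IsPrimitive → ∀ i j : Fin 4,
        χ (ZMod.castHom hd5 (ZMod (q * n₅)) (x i)) = χ (ZMod.castHom hd5 (ZMod (q * n₅)) (x j))) := by
  classical
  haveI : NeZero (q * n) := ⟨mul_ne_zero (NeZero.ne q) (NeZero.ne n)⟩
  -- the eight points
  set P : Fin 4 ⊕ Fin 4 → (ZMod (q * n))ˣ := Sum.elim x (fun i ↦ w * x i) with hP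
  have hPl : ∀ i, P (Sum.inl i) = x i := fun i ↦ rfl
  have hPr : ∀ i, P (Sum.inr i) = w * x i := fun i ↦ rfl
  have hT8 : ∀ χ : DirichletCharacter ℂ (q * n), χ.Odd → χ.IsPrimitive →
      ∑ k, (1 : ℂ) * χ (P k) = 0 := by
    intro χ hχ hp
    rw [Fintype.sum_sum_type]
    simp only [hPl, hPr, one_mul]
    exact hT χ hχ hp
  have K8 := prodForm_of_odd_primitive h hd hprim P (fun _ ↦ (1 : ℂ)) hT8
  have hfree8 : ∀ y : (ZMod q)ˣ, ∃ u : (ZMod q)ˣ, ZMod.unitsMap hd u = 1 ∧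
      ∀ k, ZMod.castHom (dvd_mul_right q n) (ZMod q) (P k) ≠ (u : ZMod q) * y ∧
        ZMod.castHom (dvd_mul_right q n) (ZMod q) (P k) ≠ -((u : ZMod q) * y) := by
    intro y
    obtain ⟨u, hu, h1, h2⟩ := hfreeAll y
    refine ⟨u, hu, ?_⟩
    rintro (i | i)
    · exact h1 i
    · exact h2 i
  obtain ⟨χ₀', hχ₀'⟩ := exists_isPrimitive (n := n) hn
  -- residues
  set r : Fin 4 → ZMod q := fun i ↦ ZMod.castHom (dvd_mul_right q n) (ZMod q) (x i) with hr
  set wq : ZMod q := ZMod.castHom (dvd_mul_right q n) (ZMod q) w with hwq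
  have hru : ∀ i, IsUnit (r i) := fun i ↦ (Units.isUnit (x i)).map _
  have hwqu : IsUnit wq := (Units.isUnit w).map _
  have hcl : ∀ i, ZMod.castHom (dvd_mul_right q n) (ZMod q) (P (Sum.inl i)) = r i := fun i ↦ rfl
  have hcr : ∀ i, ZMod.castHom (dvd_mul_right q n) (ZMod q) (P (Sum.inr i)) = wq * r i := by
    intro i; rw [hPr, Units.val_mul, map_mul]
  -- powers of `w` are never `≡ ±1`: in the forms used below
  have hwpow : ∀ L : ℕ, ZMod.castHom (dvd_mul_right q n) (ZMod q)
      ((w ^ L : (ZMod (q * n))ˣ) : ZMod (q * n)) = wq ^ L := by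
    intro L; rw [Units.val_pow_eq_pow_val, map_pow]
  have hWL : ∀ L : ℕ, 1 ≤ L → L ≤ 4 → ∀ i, ¬ (wq ^ L * r i = r i ∨ wq ^ L * r i = -r i) := by
    intro L hL1 hL4 i hc
    obtain ⟨h1, h2⟩ := hw L hL1 hL4
    rw [hwpow] at h1 h2
    rcases hc with hc | hc
    · exact h1 ((hru i).mul_right_cancel (hc.trans (one_mul _).symm))
    · exact h2 ((hru i).mul_right_cancel (hc.trans (by ring)))
  have hW1 : ∀ i, ¬ (wq * r i = r i ∨ wq * r i = -r i) := by
    intro i; have := hWL 1 le_rfl (by norm_num) i; rwa [pow_one] at this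
  have hW2 : ∀ i, ¬ (wq * (wq * r i) = r i ∨ wq * (wq * r i) = -r i) := by
    intro i; have := hWL 2 (by norm_num) (by norm_num) i; rwa [pow_two, mul_assoc] at this
  have hW3 : ∀ i, ¬ (wq * (wq * (wq * r i)) = r i ∨ wq * (wq * (wq * r i)) = -r i) := by
    intro i; have := hWL 3 (by norm_num) (by norm_num) i
    rwa [show wq ^ 3 * r i = wq * (wq * (wq * r i)) by ring] at this
  have hW4 : ∀ i, ¬ (wq * (wq * (wq * (wq * r i))) = r i ∨ wq * (wq * (wq * (wq * r i))) = -r i) := by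
    intro i; have := hWL 4 (by norm_num) le_rfl i
    rwa [show wq ^ 4 * r i = wq * (wq * (wq * (wq * r i))) by ring] at this
  -- generic block tools on the eight points
  have alone8 : ∀ k : Fin 4 ⊕ Fin 4, (∀ k', k' ≠ k →
      ZMod.castHom (dvd_mul_right q n) (ZMod q) (P k') ≠ ZMod.castHom (dvd_mul_right q n) (ZMod q) (P k) ∧
      ZMod.castHom (dvd_mul_right q n) (ZMod q) (P k') ≠ -ZMod.castHom (dvd_mul_right q n) (ZMod q) (P k)) →
      False := fun k hk ↦
    odd_alone_false hd (fun χ' ↦ χ'.IsPrimitive) ⟨χ₀', hχ₀'⟩ hq P (fun _ ↦ (1 : ℂ)) K8 hfree8 k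
      one_ne_zero hk
  have pair8 : ∀ k k' : Fin 4 ⊕ Fin 4, k ≠ k' →
      (ZMod.castHom (dvd_mul_right q n) (ZMod q) (P k') = ZMod.castHom (dvd_mul_right q n) (ZMod q) (P k) ∨
        ZMod.castHom (dvd_mul_right q n) (ZMod q) (P k') = -ZMod.castHom (dvd_mul_right q n) (ZMod q) (P k)) →
      (∀ j, j ≠ k → j ≠ k' →
        ZMod.castHom (dvd_mul_right q n) (ZMod q) (P j) ≠ ZMod.castHom (dvd_mul_right q n) (ZMod q) (P k) ∧
        ZMod.castHom (dvd_mul_right q n) (ZMod q) (P j) ≠ -ZMod.castHom (dvd_mul_right q n) (ZMod q) (P k)) →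
      ∀ χ : DirichletCharacter ℂ (q * n), χ.Odd → χ.IsPrimitive → χ (P k) + χ (P k') = 0 := by
    intro k k' hkk' hb hother χ hodd hχ
    obtain ⟨χ₁, χ', rfl, hp⟩ := exists_eq_prodChar h χ
    obtain ⟨-, h2⟩ := hp hχ
    have hpar : χ₁ (-1) * χ' (-1) = -1 := by
      have := hodd; rw [DirichletCharacter.Odd, prodChar_neg_one] at this; exact this
    have := odd_pair_of_block' hd (fun χ' ↦ χ'.IsPrimitive) hq P (fun _ ↦ (1 : ℂ)) K8 hfree8 k k'
      hkk' hb hother χ₁ χ' h2 hpar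
    rwa [one_mul, one_mul] at this
  -- index-level tools (`b = a ∨ b = -a` is "b lies in the `±`-class of a")
  have aloneS : ∀ a : Fin 4, (∀ j, j ≠ a → ¬ (r j = r a ∨ r j = -r a)) →
      (∀ j, ¬ (wq * r j = r a ∨ wq * r j = -r a)) → False := by
    intro a hS hW
    refine alone8 (Sum.inl a) ?_
    rintro (j | j) hj
    · exact not_or.mp (hS j fun h' ↦ hj (by rw [h']))
    · rw [hcr]; exact not_or.mp (hW j)
  have aloneW : ∀ a : Fin 4, (∀ j, ¬ (r j = wq * r a ∨ r j = -(wq * r a))) →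
      (∀ j, j ≠ a → ¬ (r j = r a ∨ r j = -r a)) → False := by
    intro a hS hW
    refine alone8 (Sum.inr a) ?_
    rintro (j | j) hj
    · rw [hcr]; exact not_or.mp (hS j)
    · rw [hcr, hcr]
      refine not_or.mp fun h' ↦ hW j (fun h'' ↦ hj (by rw [h''])) (pm_cancel hwqu h')
  have pairS : ∀ a b : Fin 4, a ≠ b → (r b = r a ∨ r b = -r a) →
      (∀ j, j ≠ a → j ≠ b → ¬ (r j = r a ∨ r j = -r a)) →
      (∀ j, ¬ (wq * r j = r a ∨ wq * r j = -r a)) →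
      ∀ χ : DirichletCharacter ℂ (q * n), χ.Odd → χ.IsPrimitive → χ (x a) + χ (x b) = 0 := by
    intro a b hab hb hS hW
    refine pair8 (Sum.inl a) (Sum.inl b) (by simp [hab]) hb ?_
    rintro (j | j) hja hjb
    · exact not_or.mp (hS j (fun h' ↦ hja (by rw [h'])) (fun h' ↦ hjb (by rw [h'])))
    · rw [hcr]; exact not_or.mp (hW j)
  have pairW : ∀ a b : Fin 4, a ≠ b → (r b = r a ∨ r b = -r a) →
      (∀ j, ¬ (r j = wq * r a ∨ r j = -(wq * r a))) →
      (∀ j, j ≠ a → j ≠ b → ¬ (r j = r a ∨ r j = -r a)) →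
      ∀ χ : DirichletCharacter ℂ (q * n), χ.Odd → χ.IsPrimitive → χ (x a) + χ (x b) = 0 := by
    intro a b hab hb hS hW χ hodd hχ
    have key := pair8 (Sum.inr a) (Sum.inr b) (by simp [hab]) (by rw [hcr, hcr]; exact pm_mul wq hb)
      ?_ χ hodd hχ
    · rw [hPr, hPr, Units.val_mul, Units.val_mul, map_mul, map_mul, ← mul_add] at key
      rcases mul_eq_zero.mp key with h0 | h0
      · exfalso
        have := DirichletCharacter.unit_norm_eq_one χ w
        rw [h0, norm_zero] at this; exact zero_ne_one this
      · exact h0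
    · rintro (j | j) hja hjb
      · rw [hcr]; exact not_or.mp (hS j)
      · rw [hcr, hcr]
        exact not_or.mp fun h' ↦ hW j (fun h'' ↦ hja (by rw [h''])) (fun h'' ↦ hjb (by rw [h'']))
          (pm_cancel hwqu h')
  have cover4 : ∀ a b c e : Fin 4, a ≠ b → a ≠ c → a ≠ e → b ≠ c → b ≠ e → c ≠ e →
      ∀ j : Fin 4, j = a ∨ j = b ∨ j = c ∨ j = e := by decide
  have cover3 : ∀ a b c : Fin 4, (0 : Fin 4) ≠ a → 0 ≠ b → 0 ≠ c → a ≠ b → a ≠ c → b ≠ c →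
      ∀ j : Fin 4, j ≠ c → j = 0 ∨ j = a ∨ j = b := by decide
  /- (4): concentrated -/
  have conc : (∀ i, r i = r 0 ∨ r i = -r 0) → _ := fun hall ↦ by
    refine quad_conc_of_rel h hq hn x hall fun χ' hχ' ↦ ?_
    obtain ⟨u, hu, hfu⟩ := hfree8 (ZMod.unitsMap (dvd_mul_right q n) (x 0))
    have rel := odd_rel_of_free hd (fun χ' ↦ χ'.IsPrimitive) P (fun _ ↦ (1 : ℂ)) K8 _ u hu hfu χ' hχ'
    rw [coe_unitsMap, Fintype.sum_sum_type, Fintype.sum_sum_type] at rel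
    simp only [hPl, hPr] at rel
    have hinr0 : ∀ i, ¬ (wq * r i = r 0) ∧ ¬ (wq * r i = -r 0) := fun i ↦
      not_or.mp fun h' ↦ hW1 0 (pm_trans h' (pm_symm (pm_mul wq (hall i))))
    have hz1 : ∑ i : Fin 4, (if ZMod.castHom (dvd_mul_right q n) (ZMod q) ((w * x i : (ZMod (q * n))ˣ) :
        ZMod (q * n)) = ZMod.castHom (dvd_mul_right q n) (ZMod q) (x 0) then
        (1 : ℂ) * χ' (ZMod.castHom (dvd_mul_left n q) (ZMod n) ((w * x i : (ZMod (q * n))ˣ) :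
          ZMod (q * n))) else 0) = 0 :=
      Finset.sum_eq_zero fun i _ ↦ by rw [Units.val_mul, map_mul]; exact if_neg (hinr0 i).1
    have hz2 : ∑ i : Fin 4, (if ZMod.castHom (dvd_mul_right q n) (ZMod q) ((w * x i : (ZMod (q * n))ˣ) :
        ZMod (q * n)) = -ZMod.castHom (dvd_mul_right q n) (ZMod q) (x 0) then
        (1 : ℂ) * χ' (ZMod.castHom (dvd_mul_left n q) (ZMod n) ((w * x i : (ZMod (q * n))ˣ) :
          ZMod (q * n))) else 0) = 0 :=
      Finset.sum_eq_zero fun i _ ↦ by rw [Units.val_mul, map_mul]; exact if_neg (hinr0 i).2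
    rw [hz1, hz2, add_zero, add_zero] at rel
    simpa only [one_mul] using rel
  /- (3,1): impossible -/
  have three_one : ∀ a : Fin 4, (∀ j, j ≠ a → ¬ (r j = r a ∨ r j = -r a)) →
      (∀ j k, j ≠ a → k ≠ a → (r k = r j ∨ r k = -r j)) → False := by
    intro a hS hoth
    obtain ⟨j₀, hj₀⟩ : ∃ j₀ : Fin 4, j₀ ≠ a := by
      by_cases ha : a = 0
      · exact ⟨1, by rw [ha]; decide⟩
      · exact ⟨0, fun h' ↦ ha h'.symm⟩
    by_cases hD : r a = wq * r j₀ ∨ r a = -(wq * r j₀)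
    · refine aloneW a (fun j hj ↦ ?_) hS
      by_cases hja : j = a
      · rw [hja] at hj; exact hW1 a (pm_symm hj)
      · have Z₁ : wq * r j = r a ∨ wq * r j = -r a :=
          pm_trans (pm_symm hD) (pm_mul wq (hoth j₀ j hj₀ hja))
        exact hW2 j (pm_trans (pm_symm hj) (pm_mul wq Z₁))
    · refine aloneS a hS (fun j hj ↦ ?_)
      by_cases hja : j = a
      · rw [hja] at hj; exact hW1 a hj
      · exact hD (pm_symm (pm_trans hj (pm_mul wq (hoth j j₀ hja hj₀))))
  /- (2,1,1): impossible -/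
  have two_one_one : ∀ c₁ c₂ dd ee : Fin 4, c₁ ≠ c₂ → c₁ ≠ dd → c₁ ≠ ee → c₂ ≠ dd → c₂ ≠ ee →
      dd ≠ ee → (r c₂ = r c₁ ∨ r c₂ = -r c₁) → ¬ (r dd = r c₁ ∨ r dd = -r c₁) →
      ¬ (r ee = r c₁ ∨ r ee = -r c₁) → ¬ (r ee = r dd ∨ r ee = -r dd) → False := by
    intro c₁ c₂ dd ee n12 n1d n1e n2d n2e nde h12 h1d h1e hde
    have cov := cover4 c₁ c₂ dd ee n12 n1d n1e n2d n2e nde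
    -- mates of `dd` / `ee` among the points `x_j` are excluded by the pattern
    have hWdd : ∀ j, j ≠ dd → ¬ (r j = r dd ∨ r j = -r dd) := by
      intro j hj H
      rcases cov j with rfl | rfl | rfl | rfl
      · exact h1d (pm_symm H)
      · exact h1d (pm_trans h12 (pm_symm H))
      · exact hj rfl
      · exact hde H
    have hWee : ∀ j, j ≠ ee → ¬ (r j = r ee ∨ r j = -r ee) := by
      intro j hj H
      rcases cov j with rfl | rfl | rfl | rfl
      · exact h1e (pm_symm H)
      · exact h1e (pm_trans h12 (pm_symm H))
      · exact hde (pm_symm H)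
      · exact hj rfl
    by_cases hA : r dd = wq * r c₁ ∨ r dd = -(wq * r c₁)
    · by_cases hB : r ee = wq * r dd ∨ r ee = -(wq * r dd)
      · refine aloneW ee (fun j H ↦ ?_) hWee
        have X : wq * r ee = wq * (wq * (wq * r c₁)) ∨ wq * r ee = -(wq * (wq * (wq * r c₁))) :=
          pm_mul wq (pm_trans (pm_mul wq hA) hB)
        have hc1 : ¬ (r c₁ = wq * r ee ∨ r c₁ = -(wq * r ee)) :=
          fun H' ↦ hW3 c₁ (pm_symm (pm_trans X H'))
        rcases cov j with rfl | rfl | rfl | rfl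
        · exact hc1 H
        · exact hc1 (pm_trans H (pm_symm h12))
        · exact hW2 j (pm_symm (pm_trans (pm_mul wq hB) H))
        · exact hW1 j (pm_symm H)
      · refine aloneW dd (fun j H ↦ ?_) hWdd
        have hc1 : ¬ (r c₁ = wq * r dd ∨ r c₁ = -(wq * r dd)) :=
          fun H' ↦ hW2 c₁ (pm_symm (pm_trans (pm_mul wq hA) H'))
        rcases cov j with rfl | rfl | rfl | rfl
        · exact hc1 H
        · exact hc1 (pm_trans H (pm_symm h12))
        · exact hW1 j (pm_symm H)
        · exact hB H
    · by_cases hA' : r dd = wq * r ee ∨ r dd = -(wq * r ee)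
      · by_cases hC : r ee = wq * r c₁ ∨ r ee = -(wq * r c₁)
        · refine aloneW dd (fun j H ↦ ?_) hWdd
          have X : wq * r dd = wq * (wq * (wq * r c₁)) ∨ wq * r dd = -(wq * (wq * (wq * r c₁))) :=
            pm_mul wq (pm_trans (pm_mul wq hC) hA')
          have hc1 : ¬ (r c₁ = wq * r dd ∨ r c₁ = -(wq * r dd)) :=
            fun H' ↦ hW3 c₁ (pm_symm (pm_trans X H'))
          rcases cov j with rfl | rfl | rfl | rfl
          · exact hc1 H
          · exact hc1 (pm_trans H (pm_symm h12))
          · exact hW1 j (pm_symm H)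
          · exact hW2 j (pm_symm (pm_trans (pm_mul wq hA') H))
        · refine aloneS ee hWee (fun j H ↦ ?_)
          -- `H : wq * r j` lies in the class of `r ee`
          have hc1 : ¬ (wq * r c₁ = r ee ∨ wq * r c₁ = -r ee) := fun H' ↦ hC (pm_symm H')
          rcases cov j with rfl | rfl | rfl | rfl
          · exact hc1 H
          · exact hc1 (pm_trans H (pm_symm (pm_mul wq h12)))
          · exact hW2 ee (pm_trans H (pm_symm (pm_mul wq hA')))
          · exact hW1 j H
      · refine aloneS dd hWdd (fun j H ↦ ?_)
        have hc1 : ¬ (wq * r c₁ = r dd ∨ wq * r c₁ = -r dd) := fun H' ↦ hA (pm_symm H')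
        rcases cov j with rfl | rfl | rfl | rfl
        · exact hc1 H
        · exact hc1 (pm_trans H (pm_symm (pm_mul wq h12)))
        · exact hW1 j H
        · exact hA' (pm_symm H)
  /- (1,1,1,1): impossible -/
  have one4 : (∀ i j, i ≠ j → ¬ (r j = r i ∨ r j = -r i)) → False := by
    intro hnone
    have mate : ∀ i, ∃ j, j ≠ i ∧ (wq * r j = r i ∨ wq * r j = -r i) := by
      intro i
      by_contra hc
      push Not at hc
      refine aloneS i (fun j hj ↦ hnone i j (Ne.symm hj)) fun j H ↦ ?_
      by_cases hj : j = i
      · rw [hj] at H; exact hW1 i H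
      · exact (not_or.mpr (hc j hj)) H
    obtain ⟨j₁, hj₁0, H1⟩ := mate 0
    obtain ⟨j₂, hj₂1, H2⟩ := mate j₁
    have H02 : wq * (wq * r j₂) = r 0 ∨ wq * (wq * r j₂) = -r 0 := pm_trans H1 (pm_mul wq H2)
    have hj₂0 : j₂ ≠ 0 := fun e ↦ hW2 0 (by rw [e] at H02; exact H02)
    obtain ⟨j₃, hj₃2, H3⟩ := mate j₂
    have H03 : wq * (wq * (wq * r j₃)) = r 0 ∨ wq * (wq * (wq * r j₃)) = -r 0 :=
      pm_trans H02 (pm_mul wq (pm_mul wq H3))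
    have hj₃0 : j₃ ≠ 0 := fun e ↦ hW3 0 (by rw [e] at H03; exact H03)
    have hj₃1 : j₃ ≠ j₁ := fun e ↦ by
      rw [e] at H3
      exact hW2 j₁ (pm_trans H2 (pm_mul wq H3))
    obtain ⟨j₄, hj₄3, H4⟩ := mate j₃
    rcases cover3 j₁ j₂ j₃ hj₁0.symm hj₂0.symm hj₃0.symm hj₂1.symm hj₃1.symm hj₃2.symm j₄ hj₄3 with
      e | e | e
    · rw [e] at H4
      exact hW4 0 (pm_trans H03 (pm_mul wq (pm_mul wq (pm_mul wq H4))))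
    · rw [e] at H4
      exact hW3 j₁ (pm_trans H2 (pm_mul wq (pm_trans H3 (pm_mul wq H4))))
    · rw [e] at H4
      exact hW2 j₂ (pm_trans H3 (pm_mul wq H4))
  /- (2,2): split -/
  have two_two : ∀ a b c e : Fin 4, a ≠ b → a ≠ c → a ≠ e → b ≠ c → b ≠ e → c ≠ e →
      (r b = r a ∨ r b = -r a) → (r e = r c ∨ r e = -r c) → ¬ (r c = r a ∨ r c = -r a) →
      (∀ χ : DirichletCharacter ℂ (q * n), χ.Odd → χ.IsPrimitive → χ (x a) + χ (x b) = 0) ∧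
      (∀ χ : DirichletCharacter ℂ (q * n), χ.Odd → χ.IsPrimitive → χ (x c) + χ (x e) = 0) := by
    intro a b c e nab nac nae nbc nbe nce hab hce hac
    have cov := cover4 a b c e nab nac nae nbc nbe nce
    have hS_ab : ∀ j, j ≠ a → j ≠ b → ¬ (r j = r a ∨ r j = -r a) := by
      intro j hja hjb H
      rcases cov j with rfl | rfl | rfl | rfl
      · exact hja rfl
      · exact hjb rfl
      · exact hac H
      · exact hac (pm_trans H (pm_symm hce))
    have hS_ce : ∀ j, j ≠ c → j ≠ e → ¬ (r j = r c ∨ r j = -r c) := by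
      intro j hjc hje H
      rcases cov j with rfl | rfl | rfl | rfl
      · exact hac (pm_symm H)
      · exact hac (pm_symm (pm_trans H (pm_symm hab)))
      · exact hjc rfl
      · exact hje rfl
    by_cases hD : r c = wq * r a ∨ r c = -(wq * r a)
    · refine ⟨pairS a b nab hab hS_ab (fun j H ↦ ?_), pairW c e nce hce (fun j H ↦ ?_) hS_ce⟩
      · have hc' : ¬ (wq * r c = r a ∨ wq * r c = -r a) :=
          fun H' ↦ hW2 a (pm_trans H' (pm_symm (pm_mul wq hD)))
        rcases cov j with rfl | rfl | rfl | rfl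
        · exact hW1 j H
        · exact hW1 a (pm_trans H (pm_symm (pm_mul wq hab)))
        · exact hc' H
        · exact hc' (pm_trans H (pm_symm (pm_mul wq hce)))
      · have ha' : ¬ (r a = wq * r c ∨ r a = -(wq * r c)) :=
          fun H' ↦ hW2 a (pm_symm (pm_trans (pm_mul wq hD) H'))
        rcases cov j with rfl | rfl | rfl | rfl
        · exact ha' H
        · exact ha' (pm_trans H (pm_symm hab))
        · exact hW1 j (pm_symm H)
        · exact hW1 c (pm_symm (pm_trans H (pm_symm hce)))
    · by_cases hD' : r a = wq * r c ∨ r a = -(wq * r c)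
      · refine ⟨pairW a b nab hab (fun j H ↦ ?_) hS_ab, pairS c e nce hce hS_ce (fun j H ↦ ?_)⟩
        · have hc' : ¬ (r c = wq * r a ∨ r c = -(wq * r a)) :=
            fun H' ↦ hW2 c (pm_symm (pm_trans (pm_mul wq hD') H'))
          rcases cov j with rfl | rfl | rfl | rfl
          · exact hW1 j (pm_symm H)
          · exact hW1 a (pm_symm (pm_trans H (pm_symm hab)))
          · exact hc' H
          · exact hc' (pm_trans H (pm_symm hce))
        · have ha' : ¬ (wq * r a = r c ∨ wq * r a = -r c) :=
            fun H' ↦ hW2 c (pm_trans H' (pm_symm (pm_mul wq hD')))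
          rcases cov j with rfl | rfl | rfl | rfl
          · exact ha' H
          · exact ha' (pm_trans H (pm_symm (pm_mul wq hab)))
          · exact hW1 j H
          · exact hW1 c (pm_trans H (pm_symm (pm_mul wq hce)))
      · refine ⟨pairS a b nab hab hS_ab (fun j H ↦ ?_), pairS c e nce hce hS_ce (fun j H ↦ ?_)⟩
        · rcases cov j with rfl | rfl | rfl | rfl
          · exact hW1 j H
          · exact hW1 a (pm_trans H (pm_symm (pm_mul wq hab)))
          · exact hD' (pm_symm H)
          · exact hD' (pm_symm (pm_trans H (pm_symm (pm_mul wq hce))))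
        · rcases cov j with rfl | rfl | rfl | rfl
          · exact hD (pm_symm H)
          · exact hD (pm_symm (pm_trans H (pm_symm (pm_mul wq hab))))
          · exact hW1 j H
          · exact hW1 c (pm_trans H (pm_symm (pm_mul wq hce)))
  /- dispatch on the pattern of `r 1, r 2, r 3` relative to `r 0` -/
  have notB : ∀ i j, ¬ (r j = r i ∨ r j = -r i) → ¬ (r i = r j ∨ r i = -r j) :=
    fun i j hn hb ↦ hn (pm_symm hb)
  by_cases h1 : r 1 = r 0 ∨ r 1 = -r 0 <;> by_cases h2 : r 2 = r 0 ∨ r 2 = -r 0 <;>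
    by_cases h3 : r 3 = r 0 ∨ r 3 = -r 0
  · refine conc fun i ↦ ?_
    fin_cases i
    · exact Or.inl rfl
    · exact h1
    · exact h2
    · exact h3
  · exfalso
    refine three_one 3 (fun j hj ↦ ?_) (fun j k hj hk ↦ ?_)
    · fin_cases j
      · exact notB _ _ h3
      · exact fun H ↦ h3 (pm_trans h1 (pm_symm H))
      · exact fun H ↦ h3 (pm_trans h2 (pm_symm H))
      · exact absurd rfl hj
    · have hj' : r j = r 0 ∨ r j = -r 0 := by
        fin_cases j
        · exact Or.inl rfl
        · exact h1
        · exact h2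
        · exact absurd rfl hj
      have hk' : r k = r 0 ∨ r k = -r 0 := by
        fin_cases k
        · exact Or.inl rfl
        · exact h1
        · exact h2
        · exact absurd rfl hk
      exact pm_trans (pm_symm hj') hk'
  · exfalso
    refine three_one 2 (fun j hj ↦ ?_) (fun j k hj hk ↦ ?_)
    · fin_cases j
      · exact notB _ _ h2
      · exact fun H ↦ h2 (pm_trans h1 (pm_symm H))
      · exact absurd rfl hj
      · exact fun H ↦ h2 (pm_trans h3 (pm_symm H))
    · have hj' : r j = r 0 ∨ r j = -r 0 := by
        fin_cases j
        · exact Or.inl rfl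
        · exact h1
        · exact absurd rfl hj
        · exact h3
      have hk' : r k = r 0 ∨ r k = -r 0 := by
        fin_cases k
        · exact Or.inl rfl
        · exact h1
        · exact absurd rfl hk
        · exact h3
      exact pm_trans (pm_symm hj') hk'
  · by_cases h23 : r 3 = r 2 ∨ r 3 = -r 2
    · left
      obtain ⟨P1, P2⟩ := two_two 0 1 2 3 (by decide) (by decide) (by decide) (by decide) (by decide)
        (by decide) h1 h23 h2
      exact ⟨0, 1, 2, 3, by decide, by decide, by decide, by decide, by decide, by decide, P1, P2⟩
    · exfalso
      exact two_one_one 0 1 2 3 (by decide) (by decide) (by decide) (by decide) (by decide)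
        (by decide) h1 h2 h3 h23
  · exfalso
    refine three_one 1 (fun j hj ↦ ?_) (fun j k hj hk ↦ ?_)
    · fin_cases j
      · exact notB _ _ h1
      · exact absurd rfl hj
      · exact fun H ↦ h1 (pm_trans h2 (pm_symm H))
      · exact fun H ↦ h1 (pm_trans h3 (pm_symm H))
    · have hj' : r j = r 0 ∨ r j = -r 0 := by
        fin_cases j
        · exact Or.inl rfl
        · exact absurd rfl hj
        · exact h2
        · exact h3
      have hk' : r k = r 0 ∨ r k = -r 0 := by
        fin_cases k
        · exact Or.inl rfl
        · exact absurd rfl hk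
        · exact h2
        · exact h3
      exact pm_trans (pm_symm hj') hk'
  · by_cases h13 : r 3 = r 1 ∨ r 3 = -r 1
    · left
      obtain ⟨P1, P2⟩ := two_two 0 2 1 3 (by decide) (by decide) (by decide) (by decide) (by decide)
        (by decide) h2 h13 h1
      exact ⟨0, 2, 1, 3, by decide, by decide, by decide, by decide, by decide, by decide, P1, P2⟩
    · exfalso
      exact two_one_one 0 2 1 3 (by decide) (by decide) (by decide) (by decide) (by decide)
        (by decide) h2 h1 h3 h13
  · by_cases h12 : r 2 = r 1 ∨ r 2 = -r 1
    · left
      obtain ⟨P1, P2⟩ := two_two 0 3 1 2 (by decide) (by decide) (by decide) (by decide) (by decide)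
        (by decide) h3 h12 h1
      exact ⟨0, 3, 1, 2, by decide, by decide, by decide, by decide, by decide, by decide, P1, P2⟩
    · exfalso
      exact two_one_one 0 3 1 2 (by decide) (by decide) (by decide) (by decide) (by decide)
        (by decide) h3 h1 h2 h12
  · -- `r 0` alone among the `xᵢ`
    by_cases h12 : r 2 = r 1 ∨ r 2 = -r 1 <;> by_cases h13 : r 3 = r 1 ∨ r 3 = -r 1
    · exfalso
      refine three_one 0 (fun j hj ↦ ?_) (fun j k hj hk ↦ ?_)
      · fin_cases j
        · exact absurd rfl hj
        · exact h1
        · exact h2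
        · exact h3
      · have hj' : r j = r 1 ∨ r j = -r 1 := by
          fin_cases j
          · exact absurd rfl hj
          · exact Or.inl rfl
          · exact h12
          · exact h13
        have hk' : r k = r 1 ∨ r k = -r 1 := by
          fin_cases k
          · exact absurd rfl hk
          · exact Or.inl rfl
          · exact h12
          · exact h13
        exact pm_trans (pm_symm hj') hk'
    · exfalso
      exact two_one_one 1 2 0 3 (by decide) (by decide) (by decide) (by decide) (by decide)
        (by decide) h12 (notB _ _ h1) h13 h3
    · exfalso
      exact two_one_one 1 3 0 2 (by decide) (by decide) (by decide) (by decide) (by decide)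
        (by decide) h13 (notB _ _ h1) h12 h2
    · by_cases h23 : r 3 = r 2 ∨ r 3 = -r 2
      · exfalso
        exact two_one_one 2 3 0 1 (by decide) (by decide) (by decide) (by decide) (by decide)
          (by decide) h23 (notB _ _ h2) (notB _ _ h12) h1
      · exfalso
        refine one4 fun i j hij ↦ ?_
        fin_cases i <;> fin_cases j
        all_goals first | exact absurd rfl hij | skip
        · exact h1
        · exact h2
        · exact h3
        · exact notB _ _ h1
        · exact h12
        · exact h13
        · exact notB _ _ h2
        · exact notB _ _ h12
        · exact h23
        · exact notB _ _ h3
        · exact notB _ _ h13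
        · exact notB _ _ h23

/-- **Twin configurations at a prime power roomy for eight points** (`p ≥ 19`, or `p ≥ 11` with
`p² ∣ f`): the free-class hypothesis of `quad_of_twin` holds by counting.
[cite: Aoki1983, Props. 8.3, 8.4] -/
theorem quad_of_twin_primePow {p e : ℕ} (hp : p.Prime) (he1 : 1 ≤ e)
    (hbig : 19 ≤ p ∨ (2 ≤ e ∧ 11 ≤ p)) [NeZero (p ^ e)] (h : (p ^ e).Coprime n)
    (hn : Odd n ∨ 4 ∣ n) (x : Fin 4 → (ZMod (p ^ e * n))ˣ) (w : (ZMod (p ^ e * n))ˣ)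
    (hw : ∀ L : ℕ, 1 ≤ L → L ≤ 4 →
      ZMod.castHom (dvd_mul_right (p ^ e) n) (ZMod (p ^ e)) ((w ^ L : (ZMod (p ^ e * n))ˣ) :
        ZMod (p ^ e * n)) ≠ 1 ∧
      ZMod.castHom (dvd_mul_right (p ^ e) n) (ZMod (p ^ e)) ((w ^ L : (ZMod (p ^ e * n))ˣ) :
        ZMod (p ^ e * n)) ≠ -1)
    (hT : ∀ χ : DirichletCharacter ℂ (p ^ e * n), χ.Odd → χ.IsPrimitive →
      ∑ i, χ (x i) + ∑ i, χ (w * x i) = 0) :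
    (∃ i j k l : Fin 4, i ≠ j ∧ i ≠ k ∧ i ≠ l ∧ j ≠ k ∧ j ≠ l ∧ k ≠ l ∧
      (∀ χ : DirichletCharacter ℂ (p ^ e * n), χ.Odd → χ.IsPrimitive → χ (x i) + χ (x j) = 0) ∧
      (∀ χ : DirichletCharacter ℂ (p ^ e * n), χ.Odd → χ.IsPrimitive → χ (x k) + χ (x l) = 0)) ∨
    (∃ n₅ : ℕ, n = 5 * n₅ ∧ ¬ 5 ∣ n₅ ∧ ∀ (hd5 : p ^ e * n₅ ∣ p ^ e * n)
      (χ : DirichletCharacter ℂ (p ^ e * n₅)), χ.Odd → χ.IsPrimitive → ∀ i j : Fin 4,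
        χ (ZMod.castHom hd5 (ZMod (p ^ e * n₅)) (x i)) =
          χ (ZMod.castHom hd5 (ZMod (p ^ e * n₅)) (x j))) := by
  classical
  have hp11 : 11 ≤ p := by rcases hbig with h' | ⟨-, h'⟩ <;> omega
  have hp2 : p ≠ 2 := by omega
  have hq1 : 1 < p ^ e := lt_of_lt_of_le hp.one_lt (Nat.le_self_pow (by omega) p)
  haveI : Fact (1 < p ^ e) := ⟨hq1⟩
  have hd : p ^ (e - 1) ∣ p ^ e := pow_dvd_pow p (Nat.sub_le e 1)
  have hprim : ∀ χ : DirichletCharacter ℂ (p ^ e), ¬ χ.FactorsThrough (p ^ (e - 1)) →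
      χ.IsPrimitive := fun χ hχ ↦ isPrimitive_of_not_factorsThrough_primePow hp he1 χ hχ
  have hq2 : IsUnit (2 : ZMod (p ^ e)) := by
    rw [show (2 : ZMod (p ^ e)) = ((2 : ℕ) : ZMod (p ^ e)) by norm_cast, ZMod.isUnit_iff_coprime]
    exact Nat.Coprime.pow_right e ((Nat.coprime_primes Nat.prime_two hp).mpr (Ne.symm hp2))
  -- the sixteen residues, indexed by `Fin 4 ⊕ Fin 4`
  set ρ : Fin 4 ⊕ Fin 4 → (ZMod (p ^ e))ˣ :=
    Sum.elim (fun i ↦ ZMod.unitsMap (dvd_mul_right (p ^ e) n) (x i))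
      (fun i ↦ ZMod.unitsMap (dvd_mul_right (p ^ e) n) (w * x i)) with hρ
  have hcard : Fintype.card (Fin 4 ⊕ Fin 4) = 8 := by simp
  have key : ∀ y : (ZMod (p ^ e))ˣ, ∃ u : (ZMod (p ^ e))ˣ, ZMod.unitsMap hd u = 1 ∧
      ∀ k, (ρ k : ZMod (p ^ e)) ≠ (u : ZMod (p ^ e)) * y ∧
        (ρ k : ZMod (p ^ e)) ≠ -((u : ZMod (p ^ e)) * y) := by
    intro y
    rcases Nat.lt_or_ge e 2 with he2 | he2
    · have he1' : e = 1 := by omega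
      subst he1'
      have hp19 : 19 ≤ p := by rcases hbig with h' | ⟨h', -⟩ <;> omega
      refine exists_free_pm_of_card_lt hd ?_ ρ y
      rw [Finset.filter_true_of_mem (fun u _ ↦ unitsMap_eq_one_of_eq_one _ (by simp) u),
        Finset.card_univ, ZMod.card_units_eq_totient, pow_one, Nat.totient_prime hp, hcard]
      omega
    · refine exists_free_pm_of_coset hd
        (unitsMap_neg_one_ne_one hd (lt_of_lt_of_le (by omega : 2 < p)
          (Nat.le_self_pow (by omega) p))) ?_ ρ y
      rw [card_ker_primePow hp he2, hcard]
      omega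
  have hfreeAll : ∀ y : (ZMod (p ^ e))ˣ, ∃ u : (ZMod (p ^ e))ˣ, ZMod.unitsMap hd u = 1 ∧
      (∀ i, ZMod.castHom (dvd_mul_right (p ^ e) n) (ZMod (p ^ e)) (x i) ≠ (u : ZMod (p ^ e)) * y ∧
        ZMod.castHom (dvd_mul_right (p ^ e) n) (ZMod (p ^ e)) (x i) ≠ -((u : ZMod (p ^ e)) * y)) ∧
      (∀ i, ZMod.castHom (dvd_mul_right (p ^ e) n) (ZMod (p ^ e)) (w * x i) ≠ (u : ZMod (p ^ e)) * y ∧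
        ZMod.castHom (dvd_mul_right (p ^ e) n) (ZMod (p ^ e)) (w * x i) ≠
          -((u : ZMod (p ^ e)) * y)) := by
    intro y
    obtain ⟨u, hu, hfu⟩ := key y
    refine ⟨u, hu, fun i ↦ ?_, fun i ↦ ?_⟩
    · have := hfu (Sum.inl i)
      rwa [show (ρ (Sum.inl i) : ZMod (p ^ e)) =
        ZMod.castHom (dvd_mul_right (p ^ e) n) (ZMod (p ^ e)) (x i) from coe_unitsMap _ _] at this
    · have := hfu (Sum.inr i)
      rwa [show (ρ (Sum.inr i) : ZMod (p ^ e)) =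
        ZMod.castHom (dvd_mul_right (p ^ e) n) (ZMod (p ^ e)) (w * x i) from coe_unitsMap _ _] at this
  exact quad_of_twin h hd hprim hq2 hn x w hw hT hfreeAll

end Twin

end FermatCharacter

end Literature.AlgebraicGeometry.HodgeTheory
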